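import Summits.KontsevichZagierPeriods.KontsevichZagierPeriods.Theses.HurwitzMicroSectors
import Summits.KontsevichZagierPeriods.KontsevichZagierPeriods.Theorems.HurwitzMicroSectorsNormalFormPrinciplePiBoxTransfer
import Summits.KontsevichZagierPeriods.KontsevichZagierPeriods.Theorems.HurwitzMicroSectorsNormalFormPrincipleVariants2238

/-! TTRL-lite variant V2302 of stmt-KontsevichZagierPeriods-3869

Variant V2302 = `stub_boxRigidity` (the leaf `BoxRigidity` of `NormalFormPrinciple`: two representations
on open unit boxes with integrands of KZ's rational shape `p/q` and equal values are KZ-equivalent) under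
the TWO-sided move `fix_nat:m=6; bound_nat:m'≤2` (left dimension frozen to `6`, right dimension `≤ 2`).
Verdict of the attempt seat: **open** — this file is the exact-strength certificate, not a proof of the
variant. For every `K` let `BoxVanishing K` say that a box-rational representation of dimension `K` and
value `0` is a relation. With the tree's lemmas of `…Variants2238` (`boxVanishingDim_left_of_pair`:
compare with the zero representation on the other box; `boxRigidityLe_of_boxVanishingDim`: pad both
representations to the `K`-box by `pad_le` and subtract there by `sub_same`, value `0` by soundness;
`boxVanishingDim_mono`) the variant is pinned exactly:
`V2302 ⟺ BoxVanishing 6 ⟺ BoxRigidity for all m, m' ≤ 6 ⟺ V2227` (`fix_nat:m=2; fix_nat:m'=6`)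
(`stub_boxRigidity_var2302_iff_boxVanishing_six`, `…_iff_le_six`, `…_iff_var2227`); it gives
`BoxVanishing j` for every `j ≤ 6` and hence the sibling V2238 (`fix_nat:m=3; bound_nat:m'≤2`, which is
`BoxVanishing 3`). `BoxVanishing 1` is a theorem of the tree (`boxRigidity_of_le_one`, Baker); from
dimension `2` on it is open (`BoxVanishing 2 ∋` the Catalan dichotomy "`G = q ⇒ [1/(1+x²y²) − q]_□` is a
relation" for every `q : ℚ`; `BoxVanishing 5 ∋` the same for `ζ(5) = ∫_{(0,1)⁵} dx/(1 − x₁⋯x₅)`), so no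
proof of V2302 is available; conversely `KontsevichZagierPeriods → parent → V2302`
(`stub_boxRigidity_var2302_of_statement`), so a refutation of the variant would refute the Summit
(Conjecture 1 for the tree's calculus), and the tree has no invariant of `KZ.relations` finer than `eval`.
Source: M. Kontsevich, D. Zagier, *Periods* (2001), §1.2 Conjecture 1. Pure proof file, no definitions. -/

-- `Summit.<Summit>.<Problem>` is the tree's mandated summit-side namespace (CONVENTIONS §2); for this
-- single-conjunct summit the two coincide, so the duplicate is deliberate.
set_option linter.dupNamespace false

noncomputable section

namespace Summit.KontsevichZagierPeriods.KontsevichZagierPeriods.Theorems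

open MeasureTheory Set
open Literature.NumberTheory.Transcendental Literature.NumberTheory.Transcendental.KZ
open Summit.KontsevichZagierPeriods.KontsevichZagierPeriods.Theses.HurwitzMicroSectors
open Summit.KontsevichZagierPeriods.HurwitzMicroSectors.NormalFormPrinciple.PiBox

/-! ## The variant V2302 is exactly `BoxVanishing 6` -/

/-- **V2302 ⟺ `BoxVanishing 6`**: (⇒) the pair `(6, 0)` is allowed (`0 ≤ 2`), so compare a vanishing
box-rational representation on `(0,1)⁶` with the zero representation on the point
(`boxVanishingDim_left_of_pair`); (⇐) `boxRigidityLe_of_boxVanishingDim 6` with `m = 6`, `m' ≤ 2 ≤ 6`.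
[cite: KontsevichZagier2001, §1.2 Conjecture 1] -/
theorem stub_boxRigidity_var2302_iff_boxVanishing_six :
    (∀ (m' : ℕ) (N : IntegralRep 6) (N' : IntegralRep m'), m' ≤ 2 → N.domain = {x | ∀ i, x i ∈ Set.Ioo (0:ℝ) 1} → N.IsRational → N'.domain = {x | ∀ i, x i ∈ Set.Ioo (0:ℝ) 1} → N'.IsRational → N.value = N'.value → Equivalent N N') ↔
    (∀ (M : IntegralRep 6), M.domain = {x | ∀ i, x i ∈ Set.Ioo (0:ℝ) 1} → M.IsRational →
      M.value = 0 → of M ∈ relations) :=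
  ⟨fun h => boxVanishingDim_left_of_pair 6 0 fun N N' => h 0 N N' (Nat.zero_le 2),
    fun hvan m' N N' hm' =>
      boxRigidityLe_of_boxVanishingDim 6 hvan 6 m' N N' le_rfl (hm'.trans (by norm_num))⟩

/-- **V2302 ⟺ `BoxRigidity` for all `m, m' ≤ 6`** (so V2302 coincides with every two-sided sibling
`fix/bound m, m'` whose largest allowed dimension is `6`). [cite: KontsevichZagier2001, §1.2 Conjecture 1] -/
theorem stub_boxRigidity_var2302_iff_le_six :
    (∀ (m' : ℕ) (N : IntegralRep 6) (N' : IntegralRep m'), m' ≤ 2 → N.domain = {x | ∀ i, x i ∈ Set.Ioo (0:ℝ) 1} → N.IsRational → N'.domain = {x | ∀ i, x i ∈ Set.Ioo (0:ℝ) 1} → N'.IsRational → N.value = N'.value → Equivalent N N') ↔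
    (∀ (m m' : ℕ) (N : IntegralRep m) (N' : IntegralRep m'), m ≤ 6 → m' ≤ 6 →
      N.domain = {x | ∀ i, x i ∈ Set.Ioo (0:ℝ) 1} → N.IsRational →
      N'.domain = {x | ∀ i, x i ∈ Set.Ioo (0:ℝ) 1} → N'.IsRational →
      N.value = N'.value → Equivalent N N') := by
  rw [stub_boxRigidity_var2302_iff_boxVanishing_six]
  exact ⟨fun hvan => boxRigidityLe_of_boxVanishingDim 6 hvan,
    fun h => boxVanishingDim_left_of_pair 6 6 fun N N' => h 6 6 N N' le_rfl le_rfl⟩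

/-- **V2302 ⟺ the sibling V2227** (`fix_nat:m=2; fix_nat:m'=6`): both are `BoxVanishing 6`
(`boxRigidityLe_of_boxVanishingDim` one way, `boxVanishingDim_right_of_pair` the other; cf.
`stub_boxRigidity_var2227_iff_boxVanishing_six` of `…Variants2227`). [cite: KontsevichZagier2001, §1.2 Conjecture 1] -/
theorem stub_boxRigidity_var2302_iff_var2227 :
    (∀ (m' : ℕ) (N : IntegralRep 6) (N' : IntegralRep m'), m' ≤ 2 → N.domain = {x | ∀ i, x i ∈ Set.Ioo (0:ℝ) 1} → N.IsRational → N'.domain = {x | ∀ i, x i ∈ Set.Ioo (0:ℝ) 1} → N'.IsRational → N.value = N'.value → Equivalent N N') ↔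
    (∀ (N : IntegralRep 2) (N' : IntegralRep 6), N.domain = {x | ∀ i, x i ∈ Set.Ioo (0:ℝ) 1} → N.IsRational → N'.domain = {x | ∀ i, x i ∈ Set.Ioo (0:ℝ) 1} → N'.IsRational → N.value = N'.value → Equivalent N N') := by
  rw [stub_boxRigidity_var2302_iff_boxVanishing_six]
  exact ⟨fun hvan N N' => boxRigidityLe_of_boxVanishingDim 6 hvan 2 6 N N' (by norm_num) le_rfl,
    boxVanishingDim_right_of_pair 2 6⟩

/-- **V2302 ⇒ `BoxVanishing` in every dimension `≤ 6`** (monotonicity, `boxVanishingDim_mono`): in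
particular the dimension-`2` statement that every vanishing `ℚ`-combination of absolutely convergent
`∫_{(0,1)²} P/Q` is generated by the four moves. [cite: KontsevichZagier2001, §1.2 Conjecture 1] -/
theorem boxVanishing_le_six_of_stub_boxRigidity_var2302
    (h : ∀ (m' : ℕ) (N : IntegralRep 6) (N' : IntegralRep m'), m' ≤ 2 → N.domain = {x | ∀ i, x i ∈ Set.Ioo (0:ℝ) 1} → N.IsRational → N'.domain = {x | ∀ i, x i ∈ Set.Ioo (0:ℝ) 1} → N'.IsRational → N.value = N'.value → Equivalent N N')
    {j : ℕ} (hj : j ≤ 6) (N : IntegralRep j) (hNd : N.domain = {x | ∀ i, x i ∈ Set.Ioo (0:ℝ) 1})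
    (hNr : N.IsRational) (hv : N.value = 0) : of N ∈ relations :=
  boxVanishingDim_mono hj (stub_boxRigidity_var2302_iff_boxVanishing_six.1 h) N hNd hNr hv

/-- **V2302 ⇒ the sibling V2238** (`fix_nat:m=3; bound_nat:m'≤2`, which is `BoxVanishing 3`): the
two-sided variants are linearly ordered by their largest dimension. [cite: KontsevichZagier2001, §1.2 Conjecture 1] -/
theorem stub_boxRigidity_var2238_of_var2302
    (h : ∀ (m' : ℕ) (N : IntegralRep 6) (N' : IntegralRep m'), m' ≤ 2 → N.domain = {x | ∀ i, x i ∈ Set.Ioo (0:ℝ) 1} → N.IsRational → N'.domain = {x | ∀ i, x i ∈ Set.Ioo (0:ℝ) 1} → N'.IsRational → N.value = N'.value → Equivalent N N') :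
    ∀ (m' : ℕ) (N : IntegralRep 3) (N' : IntegralRep m'), m' ≤ 2 → N.domain = {x | ∀ i, x i ∈ Set.Ioo (0:ℝ) 1} → N.IsRational → N'.domain = {x | ∀ i, x i ∈ Set.Ioo (0:ℝ) 1} → N'.IsRational → N.value = N'.value → Equivalent N N' :=
  stub_boxRigidity_var2238_iff_boxVanishing_three.2 fun M hMd hMr hMv =>
    boxVanishing_le_six_of_stub_boxRigidity_var2302 h (by norm_num) M hMd hMr hMv

/-- **The parent leaf ⇒ V2302** (specialisation `m := 6`, drop the bound; the converse is not claimed —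
the parent is `BoxVanishing` in ALL dimensions). [cite: KontsevichZagier2001, §1.2 Conjecture 1] -/
theorem stub_boxRigidity_var2302_of_parent
    (h : ∀ (m m' : ℕ) (N : IntegralRep m) (N' : IntegralRep m'), N.domain = {x | ∀ i, x i ∈ Set.Ioo (0:ℝ) 1} → N.IsRational → N'.domain = {x | ∀ i, x i ∈ Set.Ioo (0:ℝ) 1} → N'.IsRational → N.value = N'.value → Equivalent N N') :
    ∀ (m' : ℕ) (N : IntegralRep 6) (N' : IntegralRep m'), m' ≤ 2 → N.domain = {x | ∀ i, x i ∈ Set.Ioo (0:ℝ) 1} → N.IsRational → N'.domain = {x | ∀ i, x i ∈ Set.Ioo (0:ℝ) 1} → N'.IsRational → N.value = N'.value → Equivalent N N' :=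
  fun m' N N' _ => h 6 m' N N'

/-- **`KontsevichZagierPeriods ⇒ V2302`**: the variant is a special case of Conjecture 1 for the tree's
calculus (`leaves_of_statement`) — so a refutation of the variant would refute the Summit.
[cite: KontsevichZagier2001, §1.2 Conjecture 1] -/
theorem stub_boxRigidity_var2302_of_statement (h : _root_.KontsevichZagierPeriods) :
    ∀ (m' : ℕ) (N : IntegralRep 6) (N' : IntegralRep m'), m' ≤ 2 → N.domain = {x | ∀ i, x i ∈ Set.Ioo (0:ℝ) 1} → N.IsRational → N'.domain = {x | ∀ i, x i ∈ Set.Ioo (0:ℝ) 1} → N'.IsRational → N.value = N'.value → Equivalent N N' :=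
  stub_boxRigidity_var2302_of_parent (leaves_of_statement h).1

end Summit.KontsevichZagierPeriods.KontsevichZagierPeriods.Theorems

end
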